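import Summits.ResolutionOfSingularities.ResolutionOfSingularities.Theorems.EquisingularLiftEquisingularLiftNatThreePointsCI
import Mathlib.RingTheory.Polynomial.Quotient
import Mathlib.RingTheory.Localization.Away.Basic
import Mathlib.RingTheory.Localization.BaseChange
import Mathlib.RingTheory.Flat.Localization
import Mathlib.RingTheory.Spectrum.Prime.Topology
import HarnessLib

/-!
# [OURS · L1 W4.5(b) · EL♮(3) · nose residue, (c) file 2] THE MODEL RING `k[u₁,u₂][T]` of one chart of the three Steiner lines:
# the three line ideals, their intersection `𝔞`, and `𝔞 = (f, g)` once `ℓ` is inverted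

Crux chain w45b, child EL♮(3) = stmt-ResolutionOfSingularities-20148; WIDTH seat res-L1-w45b-nose-w3 g3 (D-0157 DOOR 1), brick (c) = the
×3 UNION certificate `DirStepUnobs F₂ univ (⋃ i, vertexLineStrict υ i)` (027's (U1) recipe of record, STATUS 2026-08-28T19:33Z: both charts
of the union of the three strict-transform lines have the SAME model `k[u₁,u₂][T]`, in which the union is `{(0,0),(1,0),(0,1)} × 𝔸¹` and the
generators are res-type-027's complete intersection `f = u₁(u₁−1)`, `g = u₂(u₂−1+2u₁)` on `D(ℓ)`, ✓ `…NatThreePointsCI`).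
`--supports stmt-ResolutionOfSingularities-20148 --as helper`. OURS; NOT a statement of any manuscript; AI-written, weaker than expert review.
No `sorry`; standard axioms; DEF-FREE. Resolution in positive characteristic is NOT proved here (dim 3: Cossart–Piltant 2008/2009 in print).

WHAT (pure algebra; `R₂ = MvPolynomial (Fin 2) k`, `M = MvPolynomial Unit R₂`, `𝔪_q = ker (eval q)`, `𝔮_q = 𝔪_q · M`, all written inline):
* `ThreeLines.isMaximal_ker_eval`, ★ `isPrime_map_C_ker_eval` (`M/𝔮_q ≅ k[T]`, Mathlib `quotientEquivQuotientMvPolynomial`), `X_notMem_map_C_ker_eval`,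
  `mem_map_C_ker_eval_iff` (`a ∈ 𝔮_q ↔ ∀ m, eval q (coeff m a) = 0`, Mathlib `mem_map_C_iff`);
* `C_f_mem`, `C_g_mem` — `f, g ∈ 𝔮_q` for the three points; ★ `mul_C_ell_mem_span_of_mem_inf` — for `a ∈ 𝔮₀₀ ∩ 𝔮₁₀ ∩ 𝔮₀₁`, `a · ℓ ∈ (f, g)M`
  (coefficientwise 027's ✓ `mem_span_of_eval_eq_zero`: `ℓ` kills the spurious point `(1,−1)`); ★ `map_inf_eq_map_span_of_isUnit` — under ANY ring
  map `ψ` with `ψ(ℓ)` a unit, `ψ(𝔮₀₀ ∩ 𝔮₁₀ ∩ 𝔮₀₁)·S = ψ(f, g)·S`;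
* `isRadical_inf₃`, `zeroLocus_inf₃` — the intersection is radical with zero locus the union of the three `V(𝔮_q)`;
* ★ `isQuasiRegular_fg_localization` — `(f, g)` is a quasi-regular sequence in `M[1/ℓ]` (027 ✓ `isQuasiRegular_fg_of_flat`; `R₂ → M → M[1/ℓ]` flat);
* ★ `exists_polynomial_eq_localization` — every element of `M[1/ℓ]` is a polynomial in `T` with coefficients from `R₂[1/ℓ]` (the `hT` input of the
  Laurent splitting ✓ `exists_split_mod`).

References (index only): R. Hartshorne, *Algebraic Geometry* (1977), I Ex. 2.17 [cite: Hartshorne1977]; H. Matsumura, *Commutative Ring Theory*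
(1986), Thm. 16.2 (i) [cite: Matsumura1987].
-/

set_option linter.dupNamespace false -- mandated namespace `Summit.<Summit>.<Problem>` of this single-conjunct summit

noncomputable section

open MvPolynomial

namespace Summit.ResolutionOfSingularities.ResolutionOfSingularities.Cruxes.EquisingularLiftNat.Sections

namespace ThreeLines

variable {k : Type} [Field k]

/-! ## The line ideals `𝔮_q = ker(eval q) · k[u][T]` -/

/-- `𝔪_q = ker (eval q)` is a maximal ideal of `k[u₁,u₂]` (evaluation is onto the field `k`). [folklore] -/
theorem isMaximal_ker_eval (q : Fin 2 → k) : (RingHom.ker (eval q : MvPolynomial (Fin 2) k →+* k)).IsMaximal :=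
  RingHom.ker_isMaximal_of_surjective _ fun a => ⟨C a, eval_C a⟩

/-- ★ **`𝔮_q = 𝔪_q · k[u][T]` is prime** (`k[u][T]/𝔪_q k[u][T] ≅ (k[u]/𝔪_q)[T] = k[T]`, a domain; Mathlib `quotientEquivQuotientMvPolynomial`).
[cite: Hartshorne1977, I Ex. 2.17] (folklore) -/
theorem isPrime_map_C_ker_eval (q : Fin 2 → k) :
    ((RingHom.ker (eval q : MvPolynomial (Fin 2) k →+* k)).map
      (C : MvPolynomial (Fin 2) k →+* MvPolynomial Unit (MvPolynomial (Fin 2) k))).IsPrime := by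
  haveI : (RingHom.ker (eval q : MvPolynomial (Fin 2) k →+* k)).IsMaximal := isMaximal_ker_eval q
  haveI : IsDomain (MvPolynomial (Fin 2) k ⧸ RingHom.ker (eval q : MvPolynomial (Fin 2) k →+* k)) :=
    (Ideal.Quotient.isDomain_iff_prime _).mpr (isMaximal_ker_eval q).isPrime
  haveI : IsDomain (MvPolynomial Unit (MvPolynomial (Fin 2) k) ⧸
      (RingHom.ker (eval q : MvPolynomial (Fin 2) k →+* k)).map (C : MvPolynomial (Fin 2) k →+* _)) :=
    MulEquiv.isDomain (MvPolynomial Unit (MvPolynomial (Fin 2) k ⧸ RingHom.ker (eval q : MvPolynomial (Fin 2) k →+* k)))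
      (MvPolynomial.quotientEquivQuotientMvPolynomial (RingHom.ker (eval q : MvPolynomial (Fin 2) k →+* k))).symm.toMulEquiv
  exact (Ideal.Quotient.isDomain_iff_prime _).mp inferInstance

/-- **Membership in `𝔮_q` is coefficientwise vanishing at `q`.** [folklore] -/
theorem mem_map_C_ker_eval_iff (q : Fin 2 → k) (a : MvPolynomial Unit (MvPolynomial (Fin 2) k)) :
    a ∈ (RingHom.ker (eval q : MvPolynomial (Fin 2) k →+* k)).map (C : MvPolynomial (Fin 2) k →+* MvPolynomial Unit (MvPolynomial (Fin 2) k)) ↔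
      ∀ m, eval q (a.coeff m) = 0 := by
  rw [MvPolynomial.mem_map_C_iff]
  simp only [RingHom.mem_ker]

/-- The variable `T` is not in `𝔮_q`. [folklore] -/
theorem X_notMem_map_C_ker_eval (q : Fin 2 → k) :
    (X () : MvPolynomial Unit (MvPolynomial (Fin 2) k)) ∉
      (RingHom.ker (eval q : MvPolynomial (Fin 2) k →+* k)).map (C : MvPolynomial (Fin 2) k →+* MvPolynomial Unit (MvPolynomial (Fin 2) k)) := by
  rw [mem_map_C_ker_eval_iff]
  intro h
  simpa using h (Finsupp.single () 1)

/-! ## `f`, `g`, `ℓ` and the intersection of the three line ideals -/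

/-- `f = u₁(u₁−1) ∈ 𝔮_q` for the three points. [folklore] -/
theorem C_f_mem (q : Fin 2 → k) (hq : q = ![0, 0] ∨ q = ![1, 0] ∨ q = ![0, 1]) :
    (C (X 0 * (X 0 - 1)) : MvPolynomial Unit (MvPolynomial (Fin 2) k)) ∈
      (RingHom.ker (eval q : MvPolynomial (Fin 2) k →+* k)).map (C : MvPolynomial (Fin 2) k →+* MvPolynomial Unit (MvPolynomial (Fin 2) k)) :=
  Ideal.mem_map_of_mem _ (by rw [RingHom.mem_ker]; exact ThreePointsCI.eval_f_eq_zero q hq)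

/-- `g = u₂(u₂−1+2u₁) ∈ 𝔮_q` for the three points. [folklore] -/
theorem C_g_mem (q : Fin 2 → k) (hq : q = ![0, 0] ∨ q = ![1, 0] ∨ q = ![0, 1]) :
    (C (X 1 * (X 1 - 1 + 2 * X 0)) : MvPolynomial Unit (MvPolynomial (Fin 2) k)) ∈
      (RingHom.ker (eval q : MvPolynomial (Fin 2) k →+* k)).map (C : MvPolynomial (Fin 2) k →+* MvPolynomial Unit (MvPolynomial (Fin 2) k)) :=
  Ideal.mem_map_of_mem _ (by rw [RingHom.mem_ker]; exact ThreePointsCI.eval_g_eq_zero q hq)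

/-- **`(f, g) · k[u][T] ⊆ 𝔮₀₀ ∩ 𝔮₁₀ ∩ 𝔮₀₁`.** [folklore] -/
theorem span_le_inf₃ :
    Ideal.span ({C (X 0 * (X 0 - 1)), C (X 1 * (X 1 - 1 + 2 * X 0))} : Set (MvPolynomial Unit (MvPolynomial (Fin 2) k))) ≤
      (RingHom.ker (eval ![0, 0] : MvPolynomial (Fin 2) k →+* k)).map C ⊓
        (RingHom.ker (eval ![1, 0] : MvPolynomial (Fin 2) k →+* k)).map C ⊓
          (RingHom.ker (eval ![0, 1] : MvPolynomial (Fin 2) k →+* k)).map C := by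
  rw [Ideal.span_le]
  rintro a (rfl | rfl)
  · exact ⟨⟨C_f_mem _ (Or.inl rfl), C_f_mem _ (Or.inr (Or.inl rfl))⟩, C_f_mem _ (Or.inr (Or.inr rfl))⟩
  · exact ⟨⟨C_g_mem _ (Or.inl rfl), C_g_mem _ (Or.inr (Or.inl rfl))⟩, C_g_mem _ (Or.inr (Or.inr rfl))⟩

/-- ★ **`ℓ` kills the spurious point**: for `a ∈ 𝔮₀₀ ∩ 𝔮₁₀ ∩ 𝔮₀₁`, `a · ℓ ∈ (f, g) · k[u][T]` — coefficientwise, `coeff_m(a) · ℓ` vanishes at the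
four points of `V(f, g)` (`ℓ(1,−1) = 0`), hence lies in `(f, g)` by 027's ✓ `mem_span_of_eval_eq_zero`. [cite: Hartshorne1977, I Ex. 2.17] (OURS) -/
theorem mul_C_ell_mem_span_of_mem_inf (c : k) (a : MvPolynomial Unit (MvPolynomial (Fin 2) k))
    (ha : a ∈ (RingHom.ker (eval ![0, 0] : MvPolynomial (Fin 2) k →+* k)).map C ⊓
        (RingHom.ker (eval ![1, 0] : MvPolynomial (Fin 2) k →+* k)).map C ⊓
          (RingHom.ker (eval ![0, 1] : MvPolynomial (Fin 2) k →+* k)).map C) :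
    a * C (X 1 + 1 + C c * (X 0 - 1)) ∈
      Ideal.span ({C (X 0 * (X 0 - 1)), C (X 1 * (X 1 - 1 + 2 * X 0))} : Set (MvPolynomial Unit (MvPolynomial (Fin 2) k))) := by
  have h00 := (mem_map_C_ker_eval_iff _ a).mp ha.1.1
  have h10 := (mem_map_C_ker_eval_iff _ a).mp ha.1.2
  have h01 := (mem_map_C_ker_eval_iff _ a).mp ha.2
  have hspan : Ideal.span ({C (X 0 * (X 0 - 1)), C (X 1 * (X 1 - 1 + 2 * X 0))} : Set (MvPolynomial Unit (MvPolynomial (Fin 2) k))) =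
      (Ideal.span ({X 0 * (X 0 - 1), X 1 * (X 1 - 1 + 2 * X 0)} : Set (MvPolynomial (Fin 2) k))).map
        (C : MvPolynomial (Fin 2) k →+* MvPolynomial Unit (MvPolynomial (Fin 2) k)) := by
    rw [Ideal.map_span, Set.image_pair]
  rw [hspan, MvPolynomial.mem_map_C_iff]
  intro m
  rw [show a * C (X 1 + 1 + C c * (X 0 - 1)) = C (X 1 + 1 + C c * (X 0 - 1)) * a from mul_comm _ _, MvPolynomial.coeff_C_mul]
  refine ThreePointsCI.mem_span_of_eval_eq_zero _ ?_ ?_ ?_ ?_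
  · rw [map_mul, h00 m, mul_zero]
  · rw [map_mul, h10 m, mul_zero]
  · rw [map_mul, h01 m, mul_zero]
  · rw [map_mul, ThreePointsCI.eval_ell_spurious c, zero_mul]

/-- ★ **Once `ℓ` is a unit, the intersection IS `(f, g)`**: for every ring map `ψ : k[u][T] → S` with `ψ(ℓ)` invertible,
`ψ(𝔮₀₀ ∩ 𝔮₁₀ ∩ 𝔮₀₁) · S = (ψ f, ψ g) · S`. [cite: Hartshorne1977, I Ex. 2.17] (OURS; the `hI` input of the union certificate on each chart) -/
theorem map_inf_eq_map_span_of_isUnit (c : k) {S : Type*} [CommRing S] (ψ : MvPolynomial Unit (MvPolynomial (Fin 2) k) →+* S)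
    (hu : IsUnit (ψ (C (X 1 + 1 + C c * (X 0 - 1))))) :
    ((RingHom.ker (eval ![0, 0] : MvPolynomial (Fin 2) k →+* k)).map C ⊓
        (RingHom.ker (eval ![1, 0] : MvPolynomial (Fin 2) k →+* k)).map C ⊓
          (RingHom.ker (eval ![0, 1] : MvPolynomial (Fin 2) k →+* k)).map C).map ψ =
      (Ideal.span ({C (X 0 * (X 0 - 1)), C (X 1 * (X 1 - 1 + 2 * X 0))} : Set (MvPolynomial Unit (MvPolynomial (Fin 2) k)))).map ψ := by
  apply le_antisymm
  · rw [Ideal.map_le_iff_le_comap]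
    intro a ha
    rw [Ideal.mem_comap]
    obtain ⟨u, hu'⟩ := hu
    have h1 : ψ (a * C (X 1 + 1 + C c * (X 0 - 1))) ∈
        (Ideal.span ({C (X 0 * (X 0 - 1)), C (X 1 * (X 1 - 1 + 2 * X 0))} : Set (MvPolynomial Unit (MvPolynomial (Fin 2) k)))).map ψ :=
      Ideal.mem_map_of_mem _ (mul_C_ell_mem_span_of_mem_inf c a ha)
    have h2 : ψ a = ψ (a * C (X 1 + 1 + C c * (X 0 - 1))) * ↑u⁻¹ := by
      rw [map_mul, ← hu', mul_assoc, Units.mul_inv, mul_one]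
    rw [h2]
    exact Ideal.mul_mem_right _ _ h1
  · exact Ideal.map_mono span_le_inf₃

/-- **The intersection of the three line ideals is radical** (an intersection of primes). [folklore] -/
theorem isRadical_inf₃ :
    ((RingHom.ker (eval ![0, 0] : MvPolynomial (Fin 2) k →+* k)).map
          (C : MvPolynomial (Fin 2) k →+* MvPolynomial Unit (MvPolynomial (Fin 2) k)) ⊓
        (RingHom.ker (eval ![1, 0] : MvPolynomial (Fin 2) k →+* k)).map C ⊓
          (RingHom.ker (eval ![0, 1] : MvPolynomial (Fin 2) k →+* k)).map C).IsRadical :=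
  ((isPrime_map_C_ker_eval _).isRadical.inf (isPrime_map_C_ker_eval _).isRadical).inf (isPrime_map_C_ker_eval _).isRadical

/-- **Its zero locus is the union of the three lines `V(𝔮_q)`.** [folklore] -/
theorem zeroLocus_inf₃ :
    PrimeSpectrum.zeroLocus (((RingHom.ker (eval ![0, 0] : MvPolynomial (Fin 2) k →+* k)).map
          (C : MvPolynomial (Fin 2) k →+* MvPolynomial Unit (MvPolynomial (Fin 2) k)) ⊓
        (RingHom.ker (eval ![1, 0] : MvPolynomial (Fin 2) k →+* k)).map
          (C : MvPolynomial (Fin 2) k →+* MvPolynomial Unit (MvPolynomial (Fin 2) k)) ⊓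
        (RingHom.ker (eval ![0, 1] : MvPolynomial (Fin 2) k →+* k)).map
          (C : MvPolynomial (Fin 2) k →+* MvPolynomial Unit (MvPolynomial (Fin 2) k)) :
            Ideal (MvPolynomial Unit (MvPolynomial (Fin 2) k))) : Set (MvPolynomial Unit (MvPolynomial (Fin 2) k))) =
      PrimeSpectrum.zeroLocus (((RingHom.ker (eval ![0, 0] : MvPolynomial (Fin 2) k →+* k)).map
          (C : MvPolynomial (Fin 2) k →+* MvPolynomial Unit (MvPolynomial (Fin 2) k)) :
            Ideal (MvPolynomial Unit (MvPolynomial (Fin 2) k))) : Set (MvPolynomial Unit (MvPolynomial (Fin 2) k))) ∪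
        PrimeSpectrum.zeroLocus (((RingHom.ker (eval ![1, 0] : MvPolynomial (Fin 2) k →+* k)).map
          (C : MvPolynomial (Fin 2) k →+* MvPolynomial Unit (MvPolynomial (Fin 2) k)) :
            Ideal (MvPolynomial Unit (MvPolynomial (Fin 2) k))) : Set (MvPolynomial Unit (MvPolynomial (Fin 2) k))) ∪
        PrimeSpectrum.zeroLocus (((RingHom.ker (eval ![0, 1] : MvPolynomial (Fin 2) k →+* k)).map
          (C : MvPolynomial (Fin 2) k →+* MvPolynomial Unit (MvPolynomial (Fin 2) k)) :
            Ideal (MvPolynomial Unit (MvPolynomial (Fin 2) k))) : Set (MvPolynomial Unit (MvPolynomial (Fin 2) k))) := by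
  rw [PrimeSpectrum.zeroLocus_inf, PrimeSpectrum.zeroLocus_inf]

/-- **`𝔮_q` is generated by the two translated variables** `u₁ − q₁`, `u₂ − q₂` (read in `k[u][T]`). [folklore] -/
theorem map_C_ker_eval_eq_span (q : Fin 2 → k) :
    (RingHom.ker (eval q : MvPolynomial (Fin 2) k →+* k)).map (C : MvPolynomial (Fin 2) k →+* MvPolynomial Unit (MvPolynomial (Fin 2) k)) =
      Ideal.span {C (X 0 - C (q 0)), C (X 1 - C (q 1))} := by
  have hker : RingHom.ker (eval q : MvPolynomial (Fin 2) k →+* k) = Ideal.span {X 0 - C (q 0), X 1 - C (q 1)} := by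
    apply le_antisymm
    · intro p hp
      rw [RingHom.mem_ker] at hp
      -- `p = p - C (eval q p)` and `p - C(p(q))` lies in the ideal of the point (induction on `p`)
      have key : ∀ r : MvPolynomial (Fin 2) k, r - C (eval q r) ∈ Ideal.span ({X 0 - C (q 0), X 1 - C (q 1)} : Set (MvPolynomial (Fin 2) k)) := by
        intro r
        induction r using MvPolynomial.induction_on with
        | C a => rw [eval_C, sub_self]; exact zero_mem _
        | add r s hr hs =>
          have : r + s - C (eval q (r + s)) = (r - C (eval q r)) + (s - C (eval q s)) := by rw [map_add, map_add]; ring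
          rw [this]; exact add_mem hr hs
        | mul_X r i hr =>
          have : r * X i - C (eval q (r * X i)) = (r - C (eval q r)) * X i + C (eval q r) * (X i - C (q i)) := by
            rw [map_mul, eval_X, map_mul]; ring
          rw [this]
          refine add_mem (Ideal.mul_mem_right _ _ hr) (Ideal.mul_mem_left _ _ (Ideal.subset_span ?_))
          fin_cases i
          · exact Or.inl rfl
          · exact Or.inr rfl
      have h := key p
      rwa [hp, map_zero, sub_zero] at h
    · rw [Ideal.span_le]
      rintro r (rfl | rfl)
      · rw [SetLike.mem_coe, RingHom.mem_ker, map_sub, eval_X, eval_C]; exact sub_self _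
      · rw [SetLike.mem_coe, RingHom.mem_ker, map_sub, eval_X, eval_C]; exact sub_self _
  rw [hker, Ideal.map_span, Set.image_pair]

/-! ## Quasi-regularity of `(f, g)` after inverting `ℓ`, and the polynomial form of `k[u][T][1/ℓ]` -/

/-- ★ **`(f, g)` is a quasi-regular sequence of `k[u][T][1/ℓ]`** (any localisation `L` of `k[u][T]` away from `ℓ`; 027 ✓
`isQuasiRegular_fg_of_flat`: `k[u] → k[u][T] → L` is flat). [cite: Matsumura1987, Thm. 16.2 (i)] (OURS instance) -/
theorem isQuasiRegular_fg_localization (c : k) (L : Type) [CommRing L] [Algebra (MvPolynomial Unit (MvPolynomial (Fin 2) k)) L]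
    [IsLocalization.Away ((C (X 1 + 1 + C c * (X 0 - 1)) : MvPolynomial Unit (MvPolynomial (Fin 2) k))) L] :
    Literature.AlgebraicGeometry.Resolution.IsQuasiRegular
      (![algebraMap (MvPolynomial Unit (MvPolynomial (Fin 2) k)) L (C (X 0 * (X 0 - 1))),
          algebraMap (MvPolynomial Unit (MvPolynomial (Fin 2) k)) L (C (X 1 * (X 1 - 1 + 2 * X 0)))]) := by
  letI : Algebra (MvPolynomial (Fin 2) k) L :=
    ((algebraMap (MvPolynomial Unit (MvPolynomial (Fin 2) k)) L).comp (C : MvPolynomial (Fin 2) k →+* _)).toAlgebra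
  haveI : IsScalarTower (MvPolynomial (Fin 2) k) (MvPolynomial Unit (MvPolynomial (Fin 2) k)) L :=
    IsScalarTower.of_algebraMap_eq fun r => rfl
  haveI : Module.Flat (MvPolynomial Unit (MvPolynomial (Fin 2) k)) L :=
    IsLocalization.flat L (Submonoid.powers ((C (X 1 + 1 + C c * (X 0 - 1)) : MvPolynomial Unit (MvPolynomial (Fin 2) k))))
  haveI : Module.Flat (MvPolynomial (Fin 2) k) L :=
    Module.Flat.trans (MvPolynomial (Fin 2) k) (MvPolynomial Unit (MvPolynomial (Fin 2) k)) L
  have h := ThreePointsCI.isQuasiRegular_fg_of_flat (k := k) L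
  have e : (![algebraMap (MvPolynomial (Fin 2) k) L (X 0 * (X 0 - 1)), algebraMap (MvPolynomial (Fin 2) k) L (X 1 * (X 1 - 1 + 2 * X 0))]) =
      ![algebraMap (MvPolynomial Unit (MvPolynomial (Fin 2) k)) L (C (X 0 * (X 0 - 1))),
        algebraMap (MvPolynomial Unit (MvPolynomial (Fin 2) k)) L (C (X 1 * (X 1 - 1 + 2 * X 0)))] := by
    funext i
    fin_cases i <;> rfl
  rw [← e]
  exact h

/-- ★ **Every element of `k[u][T][1/ℓ]` is a polynomial in `T` with coefficients from `k[u][1/ℓ]`** (through the natural map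
`κ : k[u][1/ℓ] → k[u][T][1/ℓ]`): the `hT` input of the Laurent splitting ✓ `exists_split_mod`. [folklore] -/
theorem exists_polynomial_eq_localization (c : k) (L₂ : Type) [CommRing L₂] [Algebra (MvPolynomial (Fin 2) k) L₂]
    [IsLocalization.Away (X 1 + 1 + C c * (X 0 - 1) : MvPolynomial (Fin 2) k) L₂]
    (L : Type) [CommRing L] [Algebra (MvPolynomial Unit (MvPolynomial (Fin 2) k)) L]
    [IsLocalization.Away ((C (X 1 + 1 + C c * (X 0 - 1)) : MvPolynomial Unit (MvPolynomial (Fin 2) k))) L] (s : L) :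
    ∃ p : Polynomial L₂,
      s = p.eval₂ (IsLocalization.Away.map L₂ L (C : MvPolynomial (Fin 2) k →+* MvPolynomial Unit (MvPolynomial (Fin 2) k))
          (X 1 + 1 + C c * (X 0 - 1)))
        (algebraMap (MvPolynomial Unit (MvPolynomial (Fin 2) k)) L (X ())) := by
  classical
  set ℓ : MvPolynomial (Fin 2) k := X 1 + 1 + C c * (X 0 - 1) with hℓ
  set κ : L₂ →+* L := IsLocalization.Away.map L₂ L (C : MvPolynomial (Fin 2) k →+* MvPolynomial Unit (MvPolynomial (Fin 2) k)) ℓ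
    with hκ
  -- `s = m / (C ℓ)^N`
  obtain ⟨⟨m, ⟨_, N, rfl⟩⟩, hs⟩ := IsLocalization.surj (Submonoid.powers (C ℓ : MvPolynomial Unit (MvPolynomial (Fin 2) k))) s
  -- the polynomial with coefficients `coeff_n(m) / ℓ^N`
  refine ⟨∑ e ∈ m.support, Polynomial.monomial (e ())
    (IsLocalization.mk' L₂ (m.coeff e) (⟨ℓ ^ N, N, rfl⟩ : Submonoid.powers ℓ)), ?_⟩
  rw [Polynomial.eval₂_finsetSum]
  simp only [Polynomial.eval₂_monomial]
  -- `κ (coeff / ℓ^N) = C coeff / (C ℓ)^N`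
  have hκ' : ∀ r : MvPolynomial (Fin 2) k, κ (IsLocalization.mk' L₂ r (⟨ℓ ^ N, N, rfl⟩ : Submonoid.powers ℓ)) =
      IsLocalization.mk' L (C r) (⟨(C ℓ) ^ N, N, rfl⟩ : Submonoid.powers (C ℓ : MvPolynomial Unit (MvPolynomial (Fin 2) k))) := by
    intro r
    rw [hκ, IsLocalization.Away.map, IsLocalization.map_mk']
    congr 1
    simp only [map_pow]
  -- `m = Σ_e C(coeff e) T^{e()}`
  have hm : m = ∑ e ∈ m.support, C (m.coeff e) * X () ^ (e ()) := by
    conv_lhs => rw [m.as_sum]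
    refine Finset.sum_congr rfl fun e _ => ?_
    rw [MvPolynomial.monomial_eq, Finsupp.prod_fintype _ _ (fun _ => pow_zero _)]
    simp only [Finset.univ_unique, Finset.prod_singleton]
  have hs' : s = IsLocalization.mk' L m (⟨(C ℓ) ^ N, N, rfl⟩ : Submonoid.powers (C ℓ : MvPolynomial Unit (MvPolynomial (Fin 2) k))) :=
    (IsLocalization.eq_mk'_iff_mul_eq (M := Submonoid.powers (C ℓ : MvPolynomial Unit (MvPolynomial (Fin 2) k)))).mpr hs
  rw [hs', IsLocalization.mk'_eq_mul_mk'_one]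
  conv_lhs => rw [hm, map_sum, Finset.sum_mul]
  refine Finset.sum_congr rfl fun e _ => ?_
  rw [hκ', IsLocalization.mk'_eq_mul_mk'_one (C (m.coeff e)), map_mul, map_pow]
  ring

end ThreeLines

end Summit.ResolutionOfSingularities.ResolutionOfSingularities.Cruxes.EquisingularLiftNat.Sections

end
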